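import Summits.NavierStokesRegularity.NavierStokesRegularity.Theses.RigidMotionDoor
import Summits.NavierStokesRegularity.NavierStokesRegularity.Theorems.UnthreadedDoorConstantSliceExtinction
import HarnessLib

/-!
# RigidMotionDoor — support twin `ConstantSliceExtinction` (item 27763), by name

The text is token-identical with the PROVED item 27409 of the Unthreaded door; closed by `exact` on the tree theorem
`unthreadedDoor_constantSliceExtinction_proof` (LINE g5-3 card, «how it closes»).  Prover ns-imp-p1 g4.
WHAT THIS IS NOT: bookkeeping for a criterion door on HYPOTHETICAL Type-I profiles; NS regularity NOT proved.
-/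

set_option linter.dupNamespace false

namespace Summit.NavierStokesRegularity.NavierStokesRegularity.Theorems

/-- **Item 27763 `RigidMotionDoor.ConstantSliceExtinction`** (twin of the Unthreaded door's 27409), by name. -/
theorem rigidMotionDoor_constantSliceExtinction_proof : Theses.RigidMotionDoor.ConstantSliceExtinction :=
  unthreadedDoor_constantSliceExtinction_proof

end Summit.NavierStokesRegularity.NavierStokesRegularity.Theorems
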